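import Summits.Ventures.Crystal3D.Theorems.StickyWulffConstantCoaxialWallLawRigidAll
import Summits.Ventures.Crystal3D.Theorems.StickyWulffConstantCoaxialWallLawRigidRimLocal
import Summits.Ventures.Crystal3D.Theorems.StickyWulffConstantCoaxialWallLawCslRigidTwin
import HarnessLib

/-!
# The rigid rung of `stub_coaxialTwoSlabAdhesion`, rim-local (`h`-free) form, for every co-axial pair

HONEST FRAMING. Part of the venture `Summits/Ventures/Crystal3D` (cell `crystal3d-full`), helper
`--supports` the crux `CoaxialWallLaw` (stmt-Ventures-19481, `route-Ventures-StickyWulffConstant`),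
REGISTERED line `WallLedgerF` (planner cf-p1 gen 16), stub `stub_coaxialTwoSlabAdhesion`.
RUNG CREDIT ONLY (rigid fillings `X ⊆ Λ₁ ∪ Λ₂`).  Rung F-C1 is not moved.

SHAPE-3 (planner ask, `h`-free error) for ALL co-axial pairs of distinct grains: the error term is
`C·ρ + 24·#{x ∈ X | (ρ−2)² < x₀² + x₁²}` (rim balls of the filling), no `h`; sine coefficient `√6/4`.

* `coaxialTwoSlabAdhesion_rigid_translate_rimLocal` — translation pairs under the axis rule
  (`coaxial_rigid_cell_ledger_rimLocal` + `translate_absorption_inPlane_moved`; rim coefficient `15/2`);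
* `coaxialTwoSlabAdhesion_rigid_translatePair_rimLocal` — the axis rule discharged by the adapted
  frame (`exists_adapted_frame`);
* `coaxialTwoSlabAdhesion_rigid_rimLocal` — every co-axial pair `Λ₁ ≠ Λ₂` (translation pairs: above;
  twin pairs: `coaxialTwoSlabAdhesion_rigid_twin_rimLocal` / `…_cslTwin_rimLocal`, constants weakened
  to the common `√6/4`, `24`).
-/

noncomputable section

namespace Summit.Ventures.Crystal3D.Theorems

open Summit.Ventures.Crystal3D Finset
open Literature.MathematicalPhysics.StatisticalMechanics (barlowPos barlowStacking fccStacking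
  constHagg IsHaggSeq isHaggSeq_const barlowPos_mem contactDeficiency)
open scoped InnerProductSpace

/-- **Translation pairs under the axis rule, rim-local form.** -/
theorem coaxialTwoSlabAdhesion_rigid_translate_rimLocal
    (A₁ : EuclideanSpace ℝ (Fin 3) ≃ₗᵢ[ℝ] EuclideanSpace ℝ (Fin 3)) (t₁ : EuclideanSpace ℝ (Fin 3))
    (A₂ : EuclideanSpace ℝ (Fin 3) ≃ₗᵢ[ℝ] EuclideanSpace ℝ (Fin 3)) (t₂ : EuclideanSpace ℝ (Fin 3))
    (L : EuclideanSpace ℝ (Fin 3) ≃ₗᵢ[ℝ] EuclideanSpace ℝ (Fin 3)) (s₁ s₂ : EuclideanSpace ℝ (Fin 3))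
    {σ σ' : ℤ → ℤ} (hσ : IsHaggSeq σ) (hσ' : IsHaggSeq σ') (h1 : σ 0 = 1) (h1' : σ' 0 = 1)
    (hsub₁ : (fun q => A₁ q + t₁) '' fccStacking 1 (Real.sqrt (2 / 3)) ⊆
      (fun p => L p + s₁) '' barlowStacking 1 (Real.sqrt (2 / 3)) σ)
    (hsub₂ : (fun q => A₂ q + t₂) '' fccStacking 1 (Real.sqrt (2 / 3)) ⊆
      (fun p => L p + s₂) '' barlowStacking 1 (Real.sqrt (2 / 3)) σ')
    (hdisj : ∀ p ∈ (fun q => A₁ q + t₁) '' fccStacking 1 (Real.sqrt (2 / 3)),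
      p ∉ (fun q => A₂ q + t₂) '' fccStacking 1 (Real.sqrt (2 / 3)))
    (haxis : ∀ w₁ ∈ fccSlots, ∀ w₂ ∈ fccSlots, ∀ w₃ ∈ fccSlots,
      dist w₁ w₂ = 1 → dist w₁ w₃ = 1 → dist w₂ w₃ = 1 → w₁ 2 = 0 →
      (2 / 3 : ℝ) • (w₁ + w₂ + w₃) - L.symm (s₂ - s₁) ∉ fccStacking 1 (Real.sqrt (2 / 3)))
    (haxis' : ∀ w₁ ∈ fccSlots, ∀ w₂ ∈ fccSlots, ∀ w₃ ∈ fccSlots,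
      dist w₁ w₂ = 1 → dist w₁ w₃ = 1 → dist w₂ w₃ = 1 → w₁ 2 = 0 →
      (2 / 3 : ℝ) • (w₁ + w₂ + w₃) - L.symm (s₁ - s₂) ∉ fccStacking 1 (Real.sqrt (2 / 3))) :
    ∃ C : ℝ, ∀ h : ℝ, ∀ ρ : ℝ, 3 ≤ ρ →
      ∀ X P₁ P₂ : Finset (EuclideanSpace ℝ (Fin 3)),
      (∀ p ∈ X, ∀ q ∈ X, p ≠ q → 1 ≤ dist p q) → P₁ ⊆ X → P₂ ⊆ X \ P₁ →
      (∀ p ∈ X, -(2 * 3) ≤ p 2 ∧ p 2 ≤ h + 2 * 3 ∧ p 0 ^ 2 + p 1 ^ 2 ≤ ρ ^ 2) →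
      (∀ p, p ∈ P₁ ↔ (p ∈ (fun q => A₁ q + t₁) '' fccStacking 1 (Real.sqrt (2 / 3)) ∧
        -(2 * 3) ≤ p 2 ∧ p 2 ≤ -3 ∧ p 0 ^ 2 + p 1 ^ 2 ≤ ρ ^ 2)) →
      (∀ p, p ∈ P₂ ↔ (p ∈ (fun q => A₂ q + t₂) '' fccStacking 1 (Real.sqrt (2 / 3)) ∧
        h + 3 ≤ p 2 ∧ p 2 ≤ h + 2 * 3 ∧ p 0 ^ 2 + p 1 ^ 2 ≤ ρ ^ 2)) →
      (∀ p ∈ X, p ∈ (fun q => A₁ q + t₁) '' fccStacking 1 (Real.sqrt (2 / 3)) ∨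
        p ∈ (fun q => A₂ q + t₂) '' fccStacking 1 (Real.sqrt (2 / 3))) →
      ((((P₁ ×ˢ (X \ P₁)).filter fun pq => dist pq.1 pq.2 = 1).card : ℕ) : ℝ) +
        ((((P₂ ×ˢ ((X \ P₁) \ P₂)).filter fun pq => dist pq.1 pq.2 = 1).card : ℕ) : ℝ) ≤
        contactDeficiency ((X \ P₁) \ P₂) +
          (Real.sqrt 2 / 4 * ∑ᶠ w ∈ {w ∈ fccStacking 1 (Real.sqrt (2 / 3)) | ‖w‖ = 1},
              |⟪w, A₁.symm (EuclideanSpace.single (2 : Fin 3) (1 : ℝ))⟫_ℝ| +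
            Real.sqrt 2 / 4 * ∑ᶠ w ∈ {w ∈ fccStacking 1 (Real.sqrt (2 / 3)) | ‖w‖ = 1},
              |⟪w, A₂.symm (EuclideanSpace.single (2 : Fin 3) (1 : ℝ))⟫_ℝ| -
            Real.sqrt 6 / 4 * Real.sqrt (1 - ⟪L (EuclideanSpace.single (2 : Fin 3) (1 : ℝ)),
              (EuclideanSpace.single (2 : Fin 3) (1 : ℝ))⟫_ℝ ^ 2)) * Real.pi * ρ ^ 2 +
          C * ρ + 15 / 2 * ((X.filter fun x => (ρ - 2) ^ 2 < x 0 ^ 2 + x 1 ^ 2).card : ℝ) := by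
  classical
  obtain ⟨C₁, hC₁⟩ := affineSampleDeficit_upper A₁ t₁ 3 (by norm_num)
  obtain ⟨C₂, hC₂⟩ := affineSampleDeficit_upper A₂ t₂ 3 (by norm_num)
  refine ⟨C₁ + C₂ + 255 / 2 * Real.sqrt 2 * Real.pi, ?_⟩
  intro h ρ hρ X P₁ P₂ hX hP₁X hP₂X₁ hcyl hP₁ hP₂ hrigid
  set e₃ : EuclideanSpace ℝ (Fin 3) := EuclideanSpace.single (2 : Fin 3) (1 : ℝ) with he₃
  set φ₁ : ℝ := Real.sqrt 2 / 4 * ∑ᶠ w ∈ {w ∈ fccStacking 1 (Real.sqrt (2 / 3)) | ‖w‖ = 1},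
      |⟪w, A₁.symm e₃⟫_ℝ| with hφ₁
  set φ₂ : ℝ := Real.sqrt 2 / 4 * ∑ᶠ w ∈ {w ∈ fccStacking 1 (Real.sqrt (2 / 3)) | ‖w‖ = 1},
      |⟪w, A₂.symm e₃⟫_ℝ| with hφ₂
  have hP₂X : P₂ ⊆ X := hP₂X₁.trans sdiff_subset
  -- frame normalisation: both grains are translates of `L·Λ₀`
  have e₁ := coaxial_frame_eq_fcc_of_one A₁ t₁ L s₁ hσ hsub₁ h1
  have e₂ := coaxial_frame_eq_fcc_of_one A₂ t₂ L s₂ hσ' hsub₂ h1'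
  -- (1) the two slab samples from above (original presentation)
  have hD₁ := hC₁ (-(2 * 3)) (-3) (by norm_num) ρ hρ P₁ hP₁
  have hD₂ := hC₂ (h + 3) (h + 2 * 3) (by ring) ρ hρ P₂ hP₂
  -- (2) the rim-local two-grain cell ledger (normalised presentation), absorption by the axis rule
  have hP₁' := hP₁
  have hP₂' := hP₂
  have hrigid' := hrigid
  have hdisj' := hdisj
  simp only [e₁, e₂] at hP₁' hP₂' hrigid' hdisj'
  have hrigid'' : ∀ p ∈ X, p ∈ (fun q => L q + s₂) '' fccStacking 1 (Real.sqrt (2 / 3)) ∨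
      p ∈ (fun q => L q + s₁) '' fccStacking 1 (Real.sqrt (2 / 3)) :=
    fun p hp => (hrigid' p hp).symm
  have habs₁ : ∀ x ∈ X, x ∈ (fun q => L q + s₁) '' fccStacking 1 (Real.sqrt (2 / 3)) →
      (fccSlots.filter fun w => w 2 = 0 ∧ x + L w ∉ X).card +
        4 * (X.filter fun q => dist x q = 1).card ≤ 48 :=
    fun x _ hxΛ => translate_absorption_inPlane_moved L s₁ s₂ X hX hrigid' x hxΛ (hdisj' x hxΛ) haxis
  have habs₂ : ∀ x ∈ X, x ∈ (fun q => L q + s₂) '' fccStacking 1 (Real.sqrt (2 / 3)) →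
      (fccSlots.filter fun w => w 2 = 0 ∧ x + L w ∉ X).card +
        4 * (X.filter fun q => dist x q = 1).card ≤ 48 :=
    fun x _ hxΛ => translate_absorption_inPlane_moved L s₂ s₁ X hX hrigid'' x hxΛ
      (fun h' => hdisj' x h' hxΛ) haxis'
  have hcell := coaxial_rigid_cell_ledger_rimLocal L s₁ L s₂ X P₁ P₂ 3 h ρ le_rfl hρ hX hcyl hP₁X hP₂X
    hP₁' hP₂' hdisj' hrigid' habs₁ habs₂
  -- the face fluxes in the crux's terms
  have hf₁ : Real.sqrt 2 / 4 * ∑ w ∈ fccSlots, |⟪L w, e₃⟫_ℝ| = φ₁ := by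
    rw [hφ₁, finsum_unit_fcc_symm_eq_sum_slots, sum_abs_inner_slots_eq_of_movedFcc_eq A₁ L t₁ s₁ e₁]
  have hf₂ : Real.sqrt 2 / 4 * ∑ w ∈ fccSlots, |⟪L w, e₃⟫_ℝ| = φ₂ := by
    rw [hφ₂, finsum_unit_fcc_symm_eq_sum_slots, sum_abs_inner_slots_eq_of_movedFcc_eq A₂ L t₂ s₂ e₂]
  -- (3) the two splits of the skeleton
  have hs₁ := contactDeficiency_sdiff_split hP₁X
  have hs₂ := contactDeficiency_sdiff_split hP₂X₁
  -- (4) assemble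
  have hC : (C₁ + C₂ + 255 / 2 * Real.sqrt 2 * Real.pi) * ρ =
      C₁ * ρ + C₂ * ρ + 255 / 2 * Real.sqrt 2 * Real.pi * ρ := by ring
  rw [hC]
  rw [hf₁] at hcell
  have hφ12 : φ₂ * Real.pi * ρ ^ 2 = φ₁ * Real.pi * ρ ^ 2 := by rw [← hf₁, ← hf₂]
  linarith [hcell, hD₁, hD₂, hs₁, hs₂, hφ12]

/-- **Translation pairs, rim-local form, axis rule discharged by the adapted frame.** -/
theorem coaxialTwoSlabAdhesion_rigid_translatePair_rimLocal
    (A₁ : EuclideanSpace ℝ (Fin 3) ≃ₗᵢ[ℝ] EuclideanSpace ℝ (Fin 3)) (t₁ : EuclideanSpace ℝ (Fin 3))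
    (A₂ : EuclideanSpace ℝ (Fin 3) ≃ₗᵢ[ℝ] EuclideanSpace ℝ (Fin 3)) (t₂ : EuclideanSpace ℝ (Fin 3))
    (hcoax : ∃ (L : EuclideanSpace ℝ (Fin 3) ≃ₗᵢ[ℝ] EuclideanSpace ℝ (Fin 3))
        (s₁ s₂ : EuclideanSpace ℝ (Fin 3)) (σ σ' : ℤ → ℤ), IsHaggSeq σ ∧ IsHaggSeq σ' ∧
        (fun p => A₁ p + t₁) '' fccStacking 1 (Real.sqrt (2 / 3)) ⊆
          (fun p => L p + s₁) '' barlowStacking 1 (Real.sqrt (2 / 3)) σ ∧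
        (fun p => A₂ p + t₂) '' fccStacking 1 (Real.sqrt (2 / 3)) ⊆
          (fun p => L p + s₂) '' barlowStacking 1 (Real.sqrt (2 / 3)) σ')
    (hsame : A₁ '' fccStacking 1 (Real.sqrt (2 / 3)) = A₂ '' fccStacking 1 (Real.sqrt (2 / 3)))
    (hdisj : ∀ p ∈ (fun q => A₁ q + t₁) '' fccStacking 1 (Real.sqrt (2 / 3)),
      p ∉ (fun q => A₂ q + t₂) '' fccStacking 1 (Real.sqrt (2 / 3))) :
    ∃ (L : EuclideanSpace ℝ (Fin 3) ≃ₗᵢ[ℝ] EuclideanSpace ℝ (Fin 3))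
        (s₁ s₂ : EuclideanSpace ℝ (Fin 3)) (σ σ' : ℤ → ℤ), IsHaggSeq σ ∧ IsHaggSeq σ' ∧
        (fun p => A₁ p + t₁) '' fccStacking 1 (Real.sqrt (2 / 3)) ⊆
          (fun p => L p + s₁) '' barlowStacking 1 (Real.sqrt (2 / 3)) σ ∧
        (fun p => A₂ p + t₂) '' fccStacking 1 (Real.sqrt (2 / 3)) ⊆
          (fun p => L p + s₂) '' barlowStacking 1 (Real.sqrt (2 / 3)) σ' ∧
    ∃ C : ℝ, ∀ h : ℝ, ∀ ρ : ℝ, 3 ≤ ρ →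
      ∀ X P₁ P₂ : Finset (EuclideanSpace ℝ (Fin 3)),
      (∀ p ∈ X, ∀ q ∈ X, p ≠ q → 1 ≤ dist p q) → P₁ ⊆ X → P₂ ⊆ X \ P₁ →
      (∀ p ∈ X, -(2 * 3) ≤ p 2 ∧ p 2 ≤ h + 2 * 3 ∧ p 0 ^ 2 + p 1 ^ 2 ≤ ρ ^ 2) →
      (∀ p, p ∈ P₁ ↔ (p ∈ (fun q => A₁ q + t₁) '' fccStacking 1 (Real.sqrt (2 / 3)) ∧
        -(2 * 3) ≤ p 2 ∧ p 2 ≤ -3 ∧ p 0 ^ 2 + p 1 ^ 2 ≤ ρ ^ 2)) →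
      (∀ p, p ∈ P₂ ↔ (p ∈ (fun q => A₂ q + t₂) '' fccStacking 1 (Real.sqrt (2 / 3)) ∧
        h + 3 ≤ p 2 ∧ p 2 ≤ h + 2 * 3 ∧ p 0 ^ 2 + p 1 ^ 2 ≤ ρ ^ 2)) →
      (∀ p ∈ X, p ∈ (fun q => A₁ q + t₁) '' fccStacking 1 (Real.sqrt (2 / 3)) ∨
        p ∈ (fun q => A₂ q + t₂) '' fccStacking 1 (Real.sqrt (2 / 3))) →
      ((((P₁ ×ˢ (X \ P₁)).filter fun pq => dist pq.1 pq.2 = 1).card : ℕ) : ℝ) +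
        ((((P₂ ×ˢ ((X \ P₁) \ P₂)).filter fun pq => dist pq.1 pq.2 = 1).card : ℕ) : ℝ) ≤
        contactDeficiency ((X \ P₁) \ P₂) +
          (Real.sqrt 2 / 4 * ∑ᶠ w ∈ {w ∈ fccStacking 1 (Real.sqrt (2 / 3)) | ‖w‖ = 1},
              |⟪w, A₁.symm (EuclideanSpace.single (2 : Fin 3) (1 : ℝ))⟫_ℝ| +
            Real.sqrt 2 / 4 * ∑ᶠ w ∈ {w ∈ fccStacking 1 (Real.sqrt (2 / 3)) | ‖w‖ = 1},
              |⟪w, A₂.symm (EuclideanSpace.single (2 : Fin 3) (1 : ℝ))⟫_ℝ| -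
            Real.sqrt 6 / 4 * Real.sqrt (1 - ⟪L (EuclideanSpace.single (2 : Fin 3) (1 : ℝ)),
              (EuclideanSpace.single (2 : Fin 3) (1 : ℝ))⟫_ℝ ^ 2)) * Real.pi * ρ ^ 2 +
          C * ρ + 15 / 2 * ((X.filter fun x => (ρ - 2) ^ 2 < x 0 ^ 2 + x 1 ^ 2).card : ℝ) := by
  obtain ⟨L, s₁, s₂, σ, σ', hσ, hσ', hsub₁, hsub₂⟩ := hcoax
  set R := (ℝ ∙ EuclideanSpace.single (2 : Fin 3) (1 : ℝ)).reflection with hR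
  -- same letter at `0`: otherwise the linear lattices differ
  have e₁ := (linear_image_eq_frame_of_subset A₁ L t₁ s₁ hσ hsub₁).2
  have e₂ := (linear_image_eq_frame_of_subset A₂ L t₂ s₂ hσ' hsub₂).2
  have hne : L '' fccStacking 1 (Real.sqrt (2 / 3)) ≠
      L '' barlowStacking 1 (Real.sqrt (2 / 3)) (fun _ : ℤ => (-1 : ℤ)) := by
    intro h
    have ht : L (barlowPos 1 (Real.sqrt (2 / 3)) constHagg 1 0 0) ∈ L '' fccStacking 1 (Real.sqrt (2 / 3)) :=
      ⟨_, barlowPos_mem _ _ _, rfl⟩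
    rw [h] at ht
    obtain ⟨q, hq, hqe⟩ := ht
    rw [L.injective hqe] at hq
    have := (mem_twin_iff_three_dvd 1 0 0).1 hq
    omega
  have hfcc : barlowStacking 1 (Real.sqrt (2 / 3)) (fun _ : ℤ => (1 : ℤ)) = fccStacking 1 (Real.sqrt (2 / 3)) := rfl
  have hframe : ∃ L₀ : EuclideanSpace ℝ (Fin 3) ≃ₗᵢ[ℝ] EuclideanSpace ℝ (Fin 3),
      (fun q => A₁ q + t₁) '' fccStacking 1 (Real.sqrt (2 / 3)) =
        (fun q => L₀ q + s₁) '' fccStacking 1 (Real.sqrt (2 / 3)) ∧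
      (fun q => A₂ q + t₂) '' fccStacking 1 (Real.sqrt (2 / 3)) =
        (fun q => L₀ q + s₂) '' fccStacking 1 (Real.sqrt (2 / 3)) := by
    rcases hσ 0 with h1 | hm1 <;> rcases hσ' 0 with h1' | hm1'
    · exact ⟨L, coaxial_frame_eq_fcc_of_one A₁ t₁ L s₁ hσ hsub₁ h1,
        coaxial_frame_eq_fcc_of_one A₂ t₂ L s₂ hσ' hsub₂ h1'⟩
    · exfalso; apply hne
      rw [h1, hfcc] at e₁; rw [hm1'] at e₂
      rw [← e₁, ← e₂]; exact hsame
    · exfalso; apply hne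
      rw [hm1] at e₁; rw [h1', hfcc] at e₂
      rw [← e₁, ← e₂]; exact hsame.symm
    · exact ⟨R.trans L, (coaxial_frame_eq_fcc_of_neg_one A₁ t₁ L s₁ hσ hsub₁ hm1).1,
        (coaxial_frame_eq_fcc_of_neg_one A₂ t₂ L s₂ hσ' hsub₂ hm1').1⟩
  obtain ⟨L₀, hg₁, hg₂⟩ := hframe
  obtain ⟨L', hL'₁, hL'₂, hax, hax'⟩ := exists_adapted_frame L₀ s₁ s₂
  have hsub₁' : (fun p => A₁ p + t₁) '' fccStacking 1 (Real.sqrt (2 / 3)) ⊆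
      (fun p => L' p + s₁) '' barlowStacking 1 (Real.sqrt (2 / 3)) constHagg := by
    rw [hg₁, ← hL'₁]; exact subset_rfl
  have hsub₂' : (fun p => A₂ p + t₂) '' fccStacking 1 (Real.sqrt (2 / 3)) ⊆
      (fun p => L' p + s₂) '' barlowStacking 1 (Real.sqrt (2 / 3)) constHagg := by
    rw [hg₂, ← hL'₂]; exact subset_rfl
  obtain ⟨C, hmain⟩ := coaxialTwoSlabAdhesion_rigid_translate_rimLocal A₁ t₁ A₂ t₂ L' s₁ s₂
    isHaggSeq_const isHaggSeq_const rfl rfl hsub₁' hsub₂' hdisj hax hax'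
  exact ⟨L', s₁, s₂, constHagg, constHagg, isHaggSeq_const, isHaggSeq_const, hsub₁', hsub₂', C, hmain⟩

/-- **The rigid rung of `stub_coaxialTwoSlabAdhesion`, rim-local form, for EVERY co-axial pair of
distinct grains** (`h`-free error `C·ρ + 24·#rim balls`, sine coefficient `√6/4`). -/
theorem coaxialTwoSlabAdhesion_rigid_rimLocal
    (A₁ : EuclideanSpace ℝ (Fin 3) ≃ₗᵢ[ℝ] EuclideanSpace ℝ (Fin 3)) (t₁ : EuclideanSpace ℝ (Fin 3))
    (A₂ : EuclideanSpace ℝ (Fin 3) ≃ₗᵢ[ℝ] EuclideanSpace ℝ (Fin 3)) (t₂ : EuclideanSpace ℝ (Fin 3))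
    (hcoax : ∃ (L : EuclideanSpace ℝ (Fin 3) ≃ₗᵢ[ℝ] EuclideanSpace ℝ (Fin 3))
        (s₁ s₂ : EuclideanSpace ℝ (Fin 3)) (σ σ' : ℤ → ℤ), IsHaggSeq σ ∧ IsHaggSeq σ' ∧
        (fun p => A₁ p + t₁) '' fccStacking 1 (Real.sqrt (2 / 3)) ⊆
          (fun p => L p + s₁) '' barlowStacking 1 (Real.sqrt (2 / 3)) σ ∧
        (fun p => A₂ p + t₂) '' fccStacking 1 (Real.sqrt (2 / 3)) ⊆
          (fun p => L p + s₂) '' barlowStacking 1 (Real.sqrt (2 / 3)) σ')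
    (hne : (fun p => A₁ p + t₁) '' fccStacking 1 (Real.sqrt (2 / 3)) ≠
      (fun p => A₂ p + t₂) '' fccStacking 1 (Real.sqrt (2 / 3))) :
    ∃ (L : EuclideanSpace ℝ (Fin 3) ≃ₗᵢ[ℝ] EuclideanSpace ℝ (Fin 3))
        (s₁ s₂ : EuclideanSpace ℝ (Fin 3)) (σ σ' : ℤ → ℤ), IsHaggSeq σ ∧ IsHaggSeq σ' ∧
        (fun p => A₁ p + t₁) '' fccStacking 1 (Real.sqrt (2 / 3)) ⊆
          (fun p => L p + s₁) '' barlowStacking 1 (Real.sqrt (2 / 3)) σ ∧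
        (fun p => A₂ p + t₂) '' fccStacking 1 (Real.sqrt (2 / 3)) ⊆
          (fun p => L p + s₂) '' barlowStacking 1 (Real.sqrt (2 / 3)) σ' ∧
    ∃ C : ℝ, ∀ h : ℝ, ∀ ρ : ℝ, 3 ≤ ρ →
      ∀ X P₁ P₂ : Finset (EuclideanSpace ℝ (Fin 3)),
      (∀ p ∈ X, ∀ q ∈ X, p ≠ q → 1 ≤ dist p q) → P₁ ⊆ X → P₂ ⊆ X \ P₁ →
      (∀ p ∈ X, -(2 * 3) ≤ p 2 ∧ p 2 ≤ h + 2 * 3 ∧ p 0 ^ 2 + p 1 ^ 2 ≤ ρ ^ 2) →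
      (∀ p, p ∈ P₁ ↔ (p ∈ (fun q => A₁ q + t₁) '' fccStacking 1 (Real.sqrt (2 / 3)) ∧
        -(2 * 3) ≤ p 2 ∧ p 2 ≤ -3 ∧ p 0 ^ 2 + p 1 ^ 2 ≤ ρ ^ 2)) →
      (∀ p, p ∈ P₂ ↔ (p ∈ (fun q => A₂ q + t₂) '' fccStacking 1 (Real.sqrt (2 / 3)) ∧
        h + 3 ≤ p 2 ∧ p 2 ≤ h + 2 * 3 ∧ p 0 ^ 2 + p 1 ^ 2 ≤ ρ ^ 2)) →
      (∀ p ∈ X, p ∈ (fun q => A₁ q + t₁) '' fccStacking 1 (Real.sqrt (2 / 3)) ∨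
        p ∈ (fun q => A₂ q + t₂) '' fccStacking 1 (Real.sqrt (2 / 3))) →
      ((((P₁ ×ˢ (X \ P₁)).filter fun pq => dist pq.1 pq.2 = 1).card : ℕ) : ℝ) +
        ((((P₂ ×ˢ ((X \ P₁) \ P₂)).filter fun pq => dist pq.1 pq.2 = 1).card : ℕ) : ℝ) ≤
        contactDeficiency ((X \ P₁) \ P₂) +
          (Real.sqrt 2 / 4 * ∑ᶠ w ∈ {w ∈ fccStacking 1 (Real.sqrt (2 / 3)) | ‖w‖ = 1},
              |⟪w, A₁.symm (EuclideanSpace.single (2 : Fin 3) (1 : ℝ))⟫_ℝ| +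
            Real.sqrt 2 / 4 * ∑ᶠ w ∈ {w ∈ fccStacking 1 (Real.sqrt (2 / 3)) | ‖w‖ = 1},
              |⟪w, A₂.symm (EuclideanSpace.single (2 : Fin 3) (1 : ℝ))⟫_ℝ| -
            Real.sqrt 6 / 4 * Real.sqrt (1 - ⟪L (EuclideanSpace.single (2 : Fin 3) (1 : ℝ)),
              (EuclideanSpace.single (2 : Fin 3) (1 : ℝ))⟫_ℝ ^ 2)) * Real.pi * ρ ^ 2 +
          C * ρ + 24 * ((X.filter fun x => (ρ - 2) ^ 2 < x 0 ^ 2 + x 1 ^ 2).card : ℝ) := by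
  by_cases hsame : A₁ '' fccStacking 1 (Real.sqrt (2 / 3)) = A₂ '' fccStacking 1 (Real.sqrt (2 / 3))
  · -- translation pair: disjoint grains, rim coefficient `15/2 ≤ 24`
    have hdisj : ∀ p ∈ (fun q => A₁ q + t₁) '' fccStacking 1 (Real.sqrt (2 / 3)),
        p ∉ (fun q => A₂ q + t₂) '' fccStacking 1 (Real.sqrt (2 / 3)) := fun p hp₁ hp₂ =>
      hne (Set.Subset.antisymm (movedFcc_subset_of_common_point A₁ t₁ A₂ t₂ hsame hp₁ hp₂)
        (movedFcc_subset_of_common_point A₂ t₂ A₁ t₁ hsame.symm hp₂ hp₁))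
    obtain ⟨L, s₁, s₂, σ, σ', hσ, hσ', hsub₁, hsub₂, C, hC⟩ :=
      coaxialTwoSlabAdhesion_rigid_translatePair_rimLocal A₁ t₁ A₂ t₂ hcoax hsame hdisj
    refine ⟨L, s₁, s₂, σ, σ', hσ, hσ', hsub₁, hsub₂, C, ?_⟩
    intro h ρ hρ X P₁ P₂ hX hP₁X hP₂X hcyl hP₁ hP₂ hrigid
    have key := hC h ρ hρ X P₁ P₂ hX hP₁X hP₂X hcyl hP₁ hP₂ hrigid
    have hr : (0 : ℝ) ≤ ((X.filter fun x => (ρ - 2) ^ 2 < x 0 ^ 2 + x 1 ^ 2).card : ℝ) :=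
      Nat.cast_nonneg _
    linarith
  · by_cases hex : ∃ c, c ∈ (fun q => A₁ q + t₁) '' fccStacking 1 (Real.sqrt (2 / 3)) ∧
        c ∈ (fun q => A₂ q + t₂) '' fccStacking 1 (Real.sqrt (2 / 3))
    · -- CSL twin pair: sine coefficient `√6/2 ≥ √6/4`
      obtain ⟨c, hc₁, hc₂⟩ := hex
      obtain ⟨L, s₁, s₂, σ, σ', hσ, hσ', hsub₁, hsub₂, C, hC⟩ :=
        coaxialTwoSlabAdhesion_rigid_cslTwin_rimLocal A₁ t₁ A₂ t₂ hcoax hsame c hc₁ hc₂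
      refine ⟨L, s₁, s₂, σ, σ', hσ, hσ', hsub₁, hsub₂, C, ?_⟩
      intro h ρ hρ X P₁ P₂ hX hP₁X hP₂X hcyl hP₁ hP₂ hrigid
      have key := hC h ρ hρ X P₁ P₂ hX hP₁X hP₂X hcyl hP₁ hP₂ hrigid
      have hS0 : (0 : ℝ) ≤ Real.sqrt (1 - ⟪L (EuclideanSpace.single (2 : Fin 3) (1 : ℝ)),
          (EuclideanSpace.single (2 : Fin 3) (1 : ℝ))⟫_ℝ ^ 2) * Real.pi * ρ ^ 2 := by positivity
      have h6 : (0 : ℝ) ≤ Real.sqrt 6 := Real.sqrt_nonneg _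
      nlinarith [mul_nonneg h6 hS0]
    · -- twin pair without coincidence sites: rim coefficient `15/2 ≤ 24`
      push Not at hex
      obtain ⟨L, s₁, s₂, σ, σ', hσ, hσ', hsub₁, hsub₂, C, hC⟩ :=
        coaxialTwoSlabAdhesion_rigid_twin_rimLocal A₁ t₁ A₂ t₂ hcoax hsame hex
      refine ⟨L, s₁, s₂, σ, σ', hσ, hσ', hsub₁, hsub₂, C, ?_⟩
      intro h ρ hρ X P₁ P₂ hX hP₁X hP₂X hcyl hP₁ hP₂ hrigid
      have key := hC h ρ hρ X P₁ P₂ hX hP₁X hP₂X hcyl hP₁ hP₂ hrigid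
      have hr : (0 : ℝ) ≤ ((X.filter fun x => (ρ - 2) ^ 2 < x 0 ^ 2 + x 1 ^ 2).card : ℝ) :=
        Nat.cast_nonneg _
      linarith

end Summit.Ventures.Crystal3D.Theorems

end
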